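import Summits.BirchSwinnertonDyer.BirchSwinnertonDyer.Theorems.KolyvaginDepthDoorMSymbolCert1477a1
import Summits.BirchSwinnertonDyer.BirchSwinnertonDyer.Theorems.KolyvaginDepthDoorMSymbolCertLevel2911
import Summits.BirchSwinnertonDyer.BirchSwinnertonDyer.Theorems.KolyvaginDepthDoorDepthTableKuriharaDecisivePair1477a1p5Cert
import HarnessLib

/-!
# Route `KolyvaginDepthDoor`, crux `KolyvaginDepthSupplyKN` (stmt-BirchSwinnertonDyer-22820) —
# DEPTH TABLE v30, DATA (Kurihara part, LEVEL `1477 = 7^1·211`) of `1477a1`: pool, Hecke data and the E-side summand at `(5, 2911 = 41·71)`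

Helper file of the lead prover of line `levelone` (kdd-p1 g35; `--supports stmt-BirchSwinnertonDyer-22820 --as helper`);
MACHINE-WRITTEN DATA + `decide` (generator `work/py/genq_lean.py`, kit 1′ `…MSymbolCertCosetsC`). Sibling of `…MSymbolCert718b1K` (kit 1′): the pool holds for the pair-indexed M-symbols of an eigenform (`relC_*` of `…MSymbolCertRelationsC`, `T₃` AND `T₅`), `T₃ = -2`, `T_5 = -1` for every newform of `1477a1` (`C1477a1.card_3/card_5`, `…DepthTableKuriharaDecisivePair1477a1p5Cert`), the unit witness `S(1/2911)`, and the summand `gE147` of the Kurihara sum (tables, inverse and Bezout data of the level in `…MSymbolCertLevel2911`), whose `2` range pieces are decided in `…MSymbolCert1477a1KSum0‥1` (74850 continued-fraction steps in all) and assembled in `…DepthTableKuriharaRow1477a1p5CertifiedE`. It closes nothing and BSD is NOT proved by it.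

References: [CremonaAlgorithms1997] §2.2–2.5, §2.8, Table 1 (1477a1); [PopaZagier2017] §4 (13); [Kim2022StructureSelmer] §1.4.3;
[MazurTateTeitelbaum1986Invent] §I.8.
-/

set_option linter.dupNamespace false
-- the packed numerals are long literals
set_option linter.style.longLine false

noncomputable section

open scoped MatrixGroups ModularForm
open CongruenceSubgroup
open Literature.NumberTheory.EllipticCurves Literature.NumberTheory.EllipticCurves.ModularForms
open Literature.NumberTheory.Automorphic.PopaZagier (coeff12 coeff12M coeff coeffN)
open Summit.BirchSwinnertonDyer.BirchSwinnertonDyer.Rank2Observatory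
open Summit.BirchSwinnertonDyer.BirchSwinnertonDyer.Rank1Residual (IntModel.frobeniusTrace_eq IntModel.minimalDiscriminantInt_eq)
open Summit.BirchSwinnertonDyer.BirchSwinnertonDyer.Theorems.KolyvaginDepthDoor.MSymbolCert.Cert389a1
  (H3 H3fin support_subset_H3fin H3fin_det H3mat_nodup H3_det H3_coeff eval_map eval_append)
open Summit.BirchSwinnertonDyer.BirchSwinnertonDyer.Theorems.KolyvaginDepthDoor.MSymbolCert.Level2911

namespace Summit.BirchSwinnertonDyer.BirchSwinnertonDyer.Theorems.KolyvaginDepthDoor.MSymbolCert.Cert1477a1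

/-! ## §1 The pool holds for an eigenform with `a₃ = -2`, `a_5 = -1` -/

/-- **The even pool holds** for `f ∈ S₂(Γ₀(1477))` with real Fourier coefficients, `a₃ = -2`, `a₅ = -1` (kit 1′:
`relC_two/three/iota/hecke` over pair indices). [cite: CremonaAlgorithms1997, §2.2–2.5] [cite: PopaZagier2017, §4 (13)] -/
theorem pool_holds (f : CuspForm (Gamma0 (7 * 211)) 2) (hreal : ∀ m, (cuspCoeff f m).im = 0)
    (hT : heckeTnGamma0 (7 * 211) 2 3 f = ((-2 : ℝ) : ℂ) • f)
    (hT5 : heckeTnGamma0 (7 * 211) 2 5 f = ((-1 : ℝ) : ℂ) • f) (k : ℕ) : eval (ΨC f) (gen1477a1 k) = 0 := by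
  set i := k / 5 with hi
  have hcases : k % 5 = 0 ∨ k % 5 = 1 ∨ k % 5 = 2 ∨ k % 5 = 3 ∨ 4 ≤ k % 5 := by omega
  rcases hcases with h | h | h | h | h
  · rw [gen1477a1, if_pos h]
    have := relC_two f i
    simp only [eval, Int.cast_one, one_mul, add_zero]
    linarith
  · rw [gen1477a1, if_neg (by omega), if_pos h]
    have := relC_iota f hreal i
    simp only [eval, Int.cast_one, one_mul, Int.reduceNeg, Int.cast_neg, neg_mul, add_zero]
    linarith
  · rw [gen1477a1, if_neg (by omega), if_neg (by omega), if_pos h]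
    have := relC_three f i
    simp only [eval, Int.cast_one, one_mul, add_zero]
    linarith
  · rw [gen1477a1, if_neg (by omega), if_neg (by omega), if_neg (by omega), if_pos h, eval_append, eval_map]
    have hH := relC_hecke f (n := 3) (by norm_num) (by norm_num) hT H3fin support_subset_H3fin H3fin_det i
    rw [H3fin, List.sum_toFinset _ H3mat_nodup, List.map_map, List.map_map] at hH
    simp only [Function.comp_def, Nat.cast_ofNat] at hH
    have hterm : ∀ t ∈ H3, (coeffN 3 (toMat t.1) : ℝ) * ΨC f (actIdxC 7 211 (toMat t.1) i) =
        (1 / 12 : ℝ) * ((t.2 : ℝ) * ΨC f (actCN 7 211 t.1 i)) := by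
      intro t ht
      rw [actCN_eq]
      have hcN : coeffN 3 (toMat t.1) = (t.2 : ℚ) / 12 := by
        have hd : (toMat t.1).det = 3 := by rw [toMat, Matrix.det_fin_two_of]; exact H3_det t ht
        unfold coeffN coeff coeff12M
        rw [if_pos hd, ← H3_coeff t ht]
        simp [toMat]
      rw [hcN]
      push_cast
      ring
    rw [List.map_congr_left hterm, List.sum_map_mul_left] at hH
    simp only [eval, Int.cast_ofNat, add_zero]
    linarith
  · rw [gen1477a1, if_neg (by omega), if_neg (by omega), if_neg (by omega), if_neg (by omega), eval_append, eval_map]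
    have hH := relC_hecke f (n := 5) (by norm_num) (by norm_num) hT5 H5fin support_subset_H5fin H5fin_det i
    rw [H5fin, List.sum_toFinset _ H5mat_nodup, List.map_map, List.map_map] at hH
    simp only [Function.comp_def, Nat.cast_ofNat] at hH
    have hterm : ∀ t ∈ H5, (coeffN 5 (toMat t.1) : ℝ) * ΨC f (actIdxC 7 211 (toMat t.1) i) =
        (1 / 12 : ℝ) * ((t.2 : ℝ) * ΨC f (actCN 7 211 t.1 i)) := by
      intro t ht
      rw [actCN_eq]
      have hcN : coeffN 5 (toMat t.1) = (t.2 : ℚ) / 12 := by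
        have hd : (toMat t.1).det = 5 := by rw [toMat, Matrix.det_fin_two_of]; exact H5_det t ht
        unfold coeffN coeff coeff12M
        rw [if_pos hd, ← H5_coeff t ht]
        simp [toMat]
      rw [hcN]
      push_cast
      ring
    rw [List.map_congr_left hterm, List.sum_map_mul_left] at hH
    simp only [eval, Int.cast_ofNat, add_zero]
    linarith

/-! ## §2 `a₃(1477a1) = -2`, `a_5(1477a1) = -1` -/

/-- **`T_3 f = -2 f` for every newform of `1477a1` at level `1477 = 7^1·211`** (`#Ẽ(𝔽_3) = 6`, kernel point count
`C1477a1.card_3`). [cite: CremonaAlgorithms1997, Table 1 (1477a1)] -/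
theorem heckeT3_1477a1 (N : ℕ) (hN : N = 7 * 211) [NeZero N]
    (D : haveI := isElliptic_c1477a1; ModularParametrizationData (((⟨1, 0, 0, -6, 7⟩ : WeierstrassCurve ℤ).map (Int.castRingHom ℚ))) N) :
    heckeTnGamma0 N 2 3 D.f = ((-2 : ℝ) : ℂ) • D.f := by
  subst hN
  haveI : Fact (Nat.Prime 3) := ⟨by norm_num⟩
  haveI : NeZero (3 : ℕ) := ⟨by norm_num⟩
  haveI := isElliptic_c1477a1
  haveI := isGloballyMinimal_c1477a1
  have hgood : (((⟨1, 0, 0, -6, 7⟩ : WeierstrassCurve ℤ).map (Int.castRingHom ℚ))).HasGoodReductionAtPrime 3 :=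
    WeierstrassCurve.hasGoodReductionAtPrime_of_not_dvd _ 3
      (by rw [IntModel.minimalDiscriminantInt_eq C1477a1.intModel_int]; decide +kernel)
  have hc : cuspCoeff D.f 3 = ((((⟨1, 0, 0, -6, 7⟩ : WeierstrassCurve ℤ).map (Int.castRingHom ℚ))).frobeniusTrace 3 : ℂ) :=
    cuspCoeff_eq_frobeniusTrace_of_isNewformOf_holds D.isNewformOf hgood
  have htr : (((⟨1, 0, 0, -6, 7⟩ : WeierstrassCurve ℤ).map (Int.castRingHom ℚ))).frobeniusTrace 3 = -2 := by
    rw [IntModel.frobeniusTrace_eq C1477a1.intModel_int C1477a1.card_3]; norm_num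
  rw [heckeTnGamma0_prime (7 * 211) 2 3 (by norm_num), IsNewform0.heckeT_eq_coeff_smul D.isNewformOf.1 (by norm_num),
    show (PowerSeries.coeff 3) (UpperHalfPlane.qExpansion 1 ⇑D.f) = cuspCoeff D.f 3 from rfl, hc, htr]
  push_cast
  rfl

/-- **`T_5 f = -1 f` for every newform of `1477a1` at level `1477 = 7^1·211`** (`#Ẽ(𝔽_5) = 7`, kernel point count
`C1477a1.card_5`). [cite: CremonaAlgorithms1997, Table 1 (1477a1)] -/
theorem heckeT5_1477a1 (N : ℕ) (hN : N = 7 * 211) [NeZero N]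
    (D : haveI := isElliptic_c1477a1; ModularParametrizationData (((⟨1, 0, 0, -6, 7⟩ : WeierstrassCurve ℤ).map (Int.castRingHom ℚ))) N) :
    heckeTnGamma0 N 2 5 D.f = ((-1 : ℝ) : ℂ) • D.f := by
  subst hN
  haveI : Fact (Nat.Prime 5) := ⟨by norm_num⟩
  haveI : NeZero (5 : ℕ) := ⟨by norm_num⟩
  haveI := isElliptic_c1477a1
  haveI := isGloballyMinimal_c1477a1
  have hgood : (((⟨1, 0, 0, -6, 7⟩ : WeierstrassCurve ℤ).map (Int.castRingHom ℚ))).HasGoodReductionAtPrime 5 :=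
    WeierstrassCurve.hasGoodReductionAtPrime_of_not_dvd _ 5
      (by rw [IntModel.minimalDiscriminantInt_eq C1477a1.intModel_int]; decide +kernel)
  have hc : cuspCoeff D.f 5 = ((((⟨1, 0, 0, -6, 7⟩ : WeierstrassCurve ℤ).map (Int.castRingHom ℚ))).frobeniusTrace 5 : ℂ) :=
    cuspCoeff_eq_frobeniusTrace_of_isNewformOf_holds D.isNewformOf hgood
  have htr : (((⟨1, 0, 0, -6, 7⟩ : WeierstrassCurve ℤ).map (Int.castRingHom ℚ))).frobeniusTrace 5 = -1 := by
    rw [IntModel.frobeniusTrace_eq C1477a1.intModel_int C1477a1.card_5]; norm_num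
  rw [heckeTnGamma0_prime (7 * 211) 2 5 (by norm_num), IsNewform0.heckeT_eq_coeff_smul D.isNewformOf.1 (by norm_num),
    show (PowerSeries.coeff 5) (UpperHalfPlane.qExpansion 1 ⇑D.f) = cuspCoeff D.f 5 from rfl, hc, htr]
  push_cast
  rfl

/-! ## §3 Kurihara data at `(5, 2911)` -/

/-- One `5`-adic unit value: `S(1/2911) = 1` (decide). [folklore] -/
theorem unit_witness : ¬ (5 : ℤ) ∣ chainSumC 7 211 phi1477a1 2912 2911 (w2911 1 : ℤ) := by
  decide +kernel

/-- The summand of the Kurihara sum of `1477a1` at `(5, 2911)` (`kSum` with the prime factors `{41, 71}` displayed). [cite: Kim2022StructureSelmer, §1.4.3] -/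
def gE147 (k : ℕ) : ZMod 5 :=
  if Nat.Coprime k 2911 then
    (chainSumC 7 211 phi1477a1 2912 2911 (w2911 k : ℤ) : ZMod 5) * ∏ ℓ ∈ ({41, 71} : Finset ℕ), tabVal (T2911 ℓ) 5 (k % ℓ)
  else 0

/-- The Kurihara sum is the range sum of `gE147`. [folklore] -/
theorem kSum_eq_sum_gE147 :
    kSum 5 2911 (fun k => chainSumC 7 211 phi1477a1 2912 2911 (w2911 k : ℤ)) (2911 : ℕ).primeFactors T2911 =
      ∑ k ∈ Finset.range 2911, gE147 k := by
  rw [primeFactors_2911]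
  rfl

end Summit.BirchSwinnertonDyer.BirchSwinnertonDyer.Theorems.KolyvaginDepthDoor.MSymbolCert.Cert1477a1

end
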